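import Summits.KontsevichZagierPeriods.KontsevichZagierPeriods.Theorems.SymplecticScissorsRealOnePeriodRelationsGreenOnSquareHelpers1

/-!
# `RealOnePeriodRelations` (stmt-KontsevichZagierPeriods-10042, route `SymplecticScissors`) — line
`nash-retraction-thin-strip`, stub `stub_greenOnSquare`: Green on the unit square

The conclusion subgroup `M₁ = closure (1a ∪ 1b ∪ 2 ∪ Green)` of the crux contains the typed GREEN
GENERATOR only on the standard closed triangle `Δ = {0 ≤ a, 0 ≤ b, a + b ≤ 1}`: for `A, B`
`ℚ`-semialgebraic and continuous on `Δ` with a potential `S` (`dS = A da + B db` on the open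
triangle) and edge representations `[∫₀¹ A(t,0) dt]`, `[∫₀¹ (B − A)(1−t,t) dt]`, `[∫₀¹ B(0,t) dt]`,
the element `[∫ A(t,0)] + [∫ (B − A)(1−t,t)] − [∫ B(0,t)]` lies in `greenSet ⊆ M₁`.

This file proves GREEN ON THE UNIT SQUARE `Q = [0,1]²` (`stub_greenOnSquare`): for typed data
`(A, B, S)` on `Q` (`S` a potential on the OPEN square) and representations `rB, rR, rT, rL` on
`(0,1)` with integrands `A(t,0)`, `B(1,t)`, `A(t,1)`, `B(0,t)`: `[rB] + [rR] − [rT] − [rL] ∈ M₁`.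
Proof: `Q = Δ ∪ σ(Δ)` with the point reflection `σ(a,b) = (1−a, 1−b)`; the first Green instance is
`(A, B, S)|_Δ` (edges `rB`, `h₁ = [∫ (B − A)(1−t,t)]`, `rL`), the second is the pulled-back data
`(−A∘σ, −B∘σ, S∘σ)` on `Δ` (`gsq_reflected_data`; edges `b₂ = [∫ −A(1−t,1)]`,
`h₂ = [∫ (A − B)(t,1−t)]`, `l₂ = [∫ −B(1,1−t)]`). The pairs `(h₁, h₂)`, `(rT, b₂)`, `(rR, l₂)` have
integrands antipodal after the reparametrisation `t ↦ 1 − t`, so each pair sums to an element of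
`M₁` (ONE rule-2 move `gsq_reflect_cov` and 1b against the zero representation,
`gsq_add_mem_of_antipodal`), and `[rB] + [rR] − [rT] − [rL]` is the resulting `ℤ`-combination.
Builds on the helper file `SymplecticScissorsRealOnePeriodRelationsGreenOnSquareHelpers1`.

## References

* M. Kontsevich, D. Zagier, *Periods* (2001), §1.2 (rules (1), (2); Stokes).
* J. Bochnak, M. Coste, M.-F. Roy, *Real Algebraic Geometry* (1998), §2.2 (Prop. 2.2.6).
-/

noncomputable section

open Set MeasureTheory
open Literature.NumberTheory.Transcendental
open Literature.ModelTheory.ExponentialFields (IsSemialgebraic)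
open Summit.KontsevichZagierPeriods.SymplecticScissors.RealOnePeriodRelationsNegative
  (M₁ greenSet unitDom Δ isSemialgebraic_unitDom)

namespace Summit.KontsevichZagierPeriods.SymplecticScissors.RealOnePeriodRelations

namespace GreenOnSquare

/-- `Δ ⊆ Q = [0,1]²`. [folklore] -/
theorem triangle_subset_square :
    Δ ⊆ {p : Fin 2 → ℝ | 0 ≤ p 0 ∧ p 0 ≤ 1 ∧ 0 ≤ p 1 ∧ p 1 ≤ 1} := fun p hp =>
  ⟨hp.1, by linarith [hp.2.1, hp.2.2], hp.2.1, by linarith [hp.1, hp.2.2]⟩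

/-- Points with both coordinates in `[0,1]` lie in `Q`. [folklore] -/
theorem vec_mem_square {a b : ℝ} (ha : 0 ≤ a) (ha' : a ≤ 1) (hb : 0 ≤ b) (hb' : b ≤ 1) :
    (![a, b] : Fin 2 → ℝ) ∈ {p : Fin 2 → ℝ | 0 ≤ p 0 ∧ p 0 ≤ 1 ∧ 0 ≤ p 1 ∧ p 1 ≤ 1} := by
  simp only [mem_setOf_eq, Matrix.cons_val_zero, Matrix.cons_val_one]
  exact ⟨ha, ha', hb, hb'⟩

/-- The reversed hypotenuse `t ↦ (t, 1 − t)` is a `ℚ`-polynomial map on the unit interval.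
[cite: BochnakCosteRoy1998, §2.2] -/
theorem isSemialgebraicMapOn_antihyp :
    IsSemialgebraicMapOn ℚ unitDom (fun z : Fin 1 → ℝ => ![z 0, 1 - z 0]) :=
  (isSemialgebraicMapOn_aeval isSemialgebraic_unitDom
    (![MvPolynomial.X 0, 1 - MvPolynomial.X 0] : Fin 2 → MvPolynomial (Fin 1) ℚ)).congr
    fun z _ => by
    ext j; fin_cases j <;> simp

/-- The reflected right edge `t ↦ (1, 1 − t)` is a `ℚ`-polynomial map on the unit interval.
[cite: BochnakCosteRoy1998, §2.2] -/
theorem isSemialgebraicMapOn_rightRefl :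
    IsSemialgebraicMapOn ℚ unitDom (fun z : Fin 1 → ℝ => ![1, 1 - z 0]) :=
  (isSemialgebraicMapOn_aeval isSemialgebraic_unitDom
    (![1, 1 - MvPolynomial.X 0] : Fin 2 → MvPolynomial (Fin 1) ℚ)).congr fun z _ => by
    ext j; fin_cases j <;> simp

/-- REFLECTION CANCELLATION: if `r, r'` are representations on `(0,1)` with
`r.integrand (1 − t) + r'.integrand t = 0` on `(0,1)`, then `[r] + [r'] ∈ M₁`: one rule-2 move with
`t ↦ 1 − t` between `−r'` and `r` (`gsq_reflect_cov`), and 1b for the antipodal pair `r', −r'`.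
[cite: KontsevichZagier2001, §1.2] -/
theorem add_mem_of_reflect (r r' : KZ.IntegralRep 1) (hr : r.domain = unitDom)
    (hr' : r'.domain = unitDom)
    (h : ∀ z ∈ unitDom, r.integrand (fun _ => 1 - z 0) + r'.integrand z = 0) :
    KZ.of r + KZ.of r' ∈ M₁ := by
  have h1 : KZ.of r'.neg - KZ.of r ∈ KZ.changeOfVariablesRel :=
    gsq_reflect_cov r'.neg r hr' hr fun z hz => by
      have hz' := h z hz
      simp only [KZ.IntegralRep.integrand_neg, Pi.neg_apply]
      linarith
  have h2 : KZ.of r' + KZ.of r'.neg ∈ M₁ :=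
    gsq_add_mem_of_antipodal greenSet r' r'.neg hr' hr' fun z _ => by simp
  convert M₁.sub_mem h2 (AddSubgroup.subset_closure (Or.inl (Or.inr h1))) using 1
  abel

end GreenOnSquare

open GreenOnSquare

/-- **Stub `stub_greenOnSquare`** (line `nash-retraction-thin-strip`). GREEN ON THE UNIT SQUARE: for
typed Green data `(A, B, S)` on the closed unit square `Q = [0,1]²` (`A, B` `ℚ`-semialgebraic and
continuous on `Q`, `S` a potential of `A da + B db` on the OPEN square) the four edge representations
satisfy `[∫₀¹ A(t,0)] + [∫₀¹ B(1,t)] − [∫₀¹ A(t,1)] − [∫₀¹ B(0,t)] ∈ M₁`: two instances of the typed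
Green generator (`Q = Δ ∪ σ(Δ)`, `σ(a,b) = (1−a,1−b)`, data `(−A∘σ, −B∘σ, S∘σ)` on the second), the
two hypotenuse densities cancelling and the reflected top/right edges matching `−[rT]`, `−[rR]` by
the reparametrisation `t ↦ 1 − t` (rule 2) and 1b. [cite: KontsevichZagier2001, §1.2] -/
theorem stub_greenOnSquare : ∀ (A B S : (Fin 2 → ℝ) → ℝ),
    IsSemialgebraicFunOn ℚ {p : Fin 2 → ℝ | 0 ≤ p 0 ∧ p 0 ≤ 1 ∧ 0 ≤ p 1 ∧ p 1 ≤ 1} A →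
    IsSemialgebraicFunOn ℚ {p : Fin 2 → ℝ | 0 ≤ p 0 ∧ p 0 ≤ 1 ∧ 0 ≤ p 1 ∧ p 1 ≤ 1} B →
    ContinuousOn A {p : Fin 2 → ℝ | 0 ≤ p 0 ∧ p 0 ≤ 1 ∧ 0 ≤ p 1 ∧ p 1 ≤ 1} →
    ContinuousOn B {p : Fin 2 → ℝ | 0 ≤ p 0 ∧ p 0 ≤ 1 ∧ 0 ≤ p 1 ∧ p 1 ≤ 1} →
    (∀ p : Fin 2 → ℝ, 0 < p 0 → p 0 < 1 → 0 < p 1 → p 1 < 1 →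
      HasFDerivAt S (A p • ContinuousLinearMap.proj (R := ℝ) (φ := fun _ : Fin 2 => ℝ) 0 +
        B p • ContinuousLinearMap.proj (R := ℝ) (φ := fun _ : Fin 2 => ℝ) 1) p) →
    ∀ (rB rR rT rL : KZ.IntegralRep 1),
      rB.domain = {z | z 0 ∈ Set.Ioo (0 : ℝ) 1} → rR.domain = {z | z 0 ∈ Set.Ioo (0 : ℝ) 1} →
      rT.domain = {z | z 0 ∈ Set.Ioo (0 : ℝ) 1} → rL.domain = {z | z 0 ∈ Set.Ioo (0 : ℝ) 1} →
      (∀ z ∈ rB.domain, rB.integrand z = A ![z 0, 0]) → (∀ z ∈ rR.domain, rR.integrand z = B ![1, z 0]) →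
      (∀ z ∈ rT.domain, rT.integrand z = A ![z 0, 1]) → (∀ z ∈ rL.domain, rL.integrand z = B ![0, z 0]) →
      KZ.of rB + KZ.of rR - KZ.of rT - KZ.of rL ∈ M₁ := by
  intro A B S hA hB hAc hBc hS rB rR rT rL hdB hdR hdT hdL hiB hiR hiT hiL
  -- the four auxiliary edges map `[0,1]` into `Q`
  have mhyp : ∀ z : Fin 1 → ℝ, z 0 ∈ Icc (0 : ℝ) 1 →
      (![1 - z 0, z 0] : Fin 2 → ℝ) ∈ {p : Fin 2 → ℝ | 0 ≤ p 0 ∧ p 0 ≤ 1 ∧ 0 ≤ p 1 ∧ p 1 ≤ 1} :=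
    fun z hz => vec_mem_square (by linarith [hz.2]) (by linarith [hz.1]) hz.1 hz.2
  have manti : ∀ z : Fin 1 → ℝ, z 0 ∈ Icc (0 : ℝ) 1 →
      (![z 0, 1 - z 0] : Fin 2 → ℝ) ∈ {p : Fin 2 → ℝ | 0 ≤ p 0 ∧ p 0 ≤ 1 ∧ 0 ≤ p 1 ∧ p 1 ≤ 1} :=
    fun z hz => vec_mem_square hz.1 hz.2 (by linarith [hz.2]) (by linarith [hz.1])
  have mtop : ∀ z : Fin 1 → ℝ, z 0 ∈ Icc (0 : ℝ) 1 →
      (![1 - z 0, 1] : Fin 2 → ℝ) ∈ {p : Fin 2 → ℝ | 0 ≤ p 0 ∧ p 0 ≤ 1 ∧ 0 ≤ p 1 ∧ p 1 ≤ 1} :=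
    fun z hz => vec_mem_square (by linarith [hz.2]) (by linarith [hz.1]) zero_le_one le_rfl
  have mright : ∀ z : Fin 1 → ℝ, z 0 ∈ Icc (0 : ℝ) 1 →
      (![1, 1 - z 0] : Fin 2 → ℝ) ∈ {p : Fin 2 → ℝ | 0 ≤ p 0 ∧ p 0 ≤ 1 ∧ 0 ≤ p 1 ∧ p 1 ≤ 1} :=
    fun z hz => vec_mem_square zero_le_one le_rfl (by linarith [hz.2]) (by linarith [hz.1])
  -- the auxiliary representations: hypotenuse `h₁`, reversed hypotenuse `h₂`, reflected top `b₂`,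
  -- reflected right `l₂`
  have th := gsq_edge_trace (F := fun p => B p - A p) (hB.fun_sub hA) (hBc.sub hAc)
    gsq_isSemialgebraicMapOn_hyp (by fun_prop) mhyp
  have ta := gsq_edge_trace (F := fun p => A p - B p) (hA.fun_sub hB) (hAc.sub hBc)
    isSemialgebraicMapOn_antihyp (by fun_prop) manti
  have tt := gsq_edge_trace hA hAc gsq_isSemialgebraicMapOn_topReflected (by fun_prop) mtop
  have tr := gsq_edge_trace hB hBc isSemialgebraicMapOn_rightRefl (by fun_prop) mright
  obtain ⟨h₁, hd₁, hi₁⟩ : ∃ r : KZ.IntegralRep 1, r.domain = unitDom ∧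
      r.integrand = fun z => B ![1 - z 0, z 0] - A ![1 - z 0, z 0] := gsq_exists_rep th.1 th.2
  obtain ⟨h₂, hd₂, hi₂⟩ : ∃ r : KZ.IntegralRep 1, r.domain = unitDom ∧
      r.integrand = fun z => A ![z 0, 1 - z 0] - B ![z 0, 1 - z 0] := gsq_exists_rep ta.1 ta.2
  obtain ⟨b₂, hdb, hib⟩ : ∃ r : KZ.IntegralRep 1, r.domain = unitDom ∧
      r.integrand = fun z => -A ![1 - z 0, 1] := gsq_exists_rep tt.1.fun_neg tt.2.neg
  obtain ⟨l₂, hdl, hil⟩ : ∃ r : KZ.IntegralRep 1, r.domain = unitDom ∧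
      r.integrand = fun z => -B ![1, 1 - z 0] := gsq_exists_rep tr.1.fun_neg tr.2.neg
  -- Green instance 1: the data restricted to `Δ ⊆ Q`, edges `rB`, `h₁`, `rL`
  have e1 : KZ.of rB + KZ.of h₁ - KZ.of rL ∈ M₁ :=
    AddSubgroup.subset_closure (Or.inr ⟨_, A, B, S, rB, h₁, rL, rfl,
      hA.mono triangle_subset_square gsq_isSemialgebraic_Δ,
      hB.mono triangle_subset_square gsq_isSemialgebraic_Δ, hAc.mono triangle_subset_square,
      hBc.mono triangle_subset_square, fun p h0 h1 h2 => hS p h0 (by linarith) h1 (by linarith),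
      hdB, hd₁, hdL, hiB, fun z _ => by simp only [hi₁], hiL, rfl⟩)
  -- Green instance 2: the data pulled back by `σ(a,b) = (1 - a, 1 - b)`, edges `b₂`, `h₂`, `l₂`
  obtain ⟨hA', hB', hAc', hBc', hS'⟩ := gsq_reflected_data rfl hA hB hAc hBc hS
  have e2 : KZ.of b₂ + KZ.of h₂ - KZ.of l₂ ∈ M₁ :=
    AddSubgroup.subset_closure (Or.inr ⟨_, _, _, _, b₂, h₂, l₂, rfl, hA', hB', hAc', hBc', hS',
      hdb, hd₂, hdl,
      fun z _ => by simp only [hib, Matrix.cons_val_zero, Matrix.cons_val_one, sub_zero],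
      fun z _ => by
        simp only [hi₂, Matrix.cons_val_zero, Matrix.cons_val_one, sub_sub_cancel]
        ring,
      fun z _ => by simp only [hil, Matrix.cons_val_zero, Matrix.cons_val_one, sub_zero], rfl⟩)
  -- the three reflected pairs
  have e3 : KZ.of h₁ + KZ.of h₂ ∈ M₁ :=
    add_mem_of_reflect h₁ h₂ hd₁ hd₂ fun z _ => by
      simp only [hi₁, hi₂, sub_sub_cancel]
      ring
  have e4 : KZ.of rT + KZ.of b₂ ∈ M₁ := by
    refine add_mem_of_reflect rT b₂ hdT hdb fun z hz => ?_
    have hw : (fun _ : Fin 1 => 1 - z 0) ∈ rT.domain := by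
      rw [hdT]
      simp only [unitDom, mem_setOf_eq, mem_Ioo] at hz ⊢
      constructor <;> linarith [hz.1, hz.2]
    simp only [hiT _ hw, hib]
    ring
  have e5 : KZ.of rR + KZ.of l₂ ∈ M₁ := by
    refine add_mem_of_reflect rR l₂ hdR hdl fun z hz => ?_
    have hw : (fun _ : Fin 1 => 1 - z 0) ∈ rR.domain := by
      rw [hdR]
      simp only [unitDom, mem_setOf_eq, mem_Ioo] at hz ⊢
      constructor <;> linarith [hz.1, hz.2]
    simp only [hiR _ hw, hil]
    ring
  convert M₁.add_mem (M₁.sub_mem (M₁.sub_mem (M₁.add_mem e1 e2) e3) e4) e5 using 1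
  abel

end Summit.KontsevichZagierPeriods.SymplecticScissors.RealOnePeriodRelations

end
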